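import Literature.Geometry.Lorentzian.KerrDeSitterHeunEquivalence
import HarnessLib

/-!
# Venture KdS — the doubly-resonant candidates, VII: the F-homotopy `y = (a − x)^p u` and the
# packaging of a smooth transformed solution as a solution of Hatsuda's connection problem

HONEST FRAMING (venture `Summits/Ventures/KdS`, cell `pub-kds`; optional kernel object of the
Monday S3 seat; general-Heun ANALYSIS plus the tree's `KerrDeSitterHeunEquivalence` vocabulary).
T10 / LIT-1 g22 / P1 g7 build the doubly-resonant candidates as `y = (z_r − x)^p u`, `p = 1 − ε`,
with `u` a polynomial solution of the F-homotoped Heun equation. This file proves the two generic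
facts behind that construction:
* `isSolutionOn_homotopy` — **the F-homotopy**: if `p(p − 1 + ε) = 0` and
  `α′β′ = αβ + p(γ + δ)`, and `u` solves `Hn(a; α′, β′; γ, δ, ε + 2p; q − pγ)` on `U ⊆ {x < a}`
  (`a` real), then `y = (a − x)^p · u` solves `Hn(a; α, β; γ, δ, ε; q)` on `U` (Umetsu's
  normalisation `GeneralHeun.IsSolutionOn`; principal power of the positive real `a − x`; the
  accessory shift `q = q′ + pγ` of T10 §1);
* `hasHeunConnectionSolution_of_homotopy` — **packaging**: on Kerr–de Sitter data with `z_r > 1`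
  and `γ = heunGamma = N + 1`, `N ∈ ℕ` (the resonant case `γ = 2 + i₀`), a function `u` that is
  `C^∞` on `ℝ`, solves the transformed equation on `(0, 1)` and does not vanish identically there
  gives, via `y = (z_r − x)^p u`, a non-trivial solution of Hatsuda's connection problem
  `HasHeunConnectionSolution M a Λ s ω m λ` (the `z^{1−γ}` branch at `0` holds with the smooth
  cofactor `G = z^{N}(z_r − z)^p u` — "cofactor vanishing at `r₊` is allowed", STRUCTURE §8 Q3 — and
  `y` is smooth across `1`). By `isRadialTeukolskySolution_of_heunSolution`,
  `isIngoingAtEventHorizon_of_heun_branch_at_zero`, `isOutgoingAtCosmoHorizon_of_heun_smooth_at_one`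
  of the tree this is a non-trivial radial Teukolsky solution on `(r₊, r_c)` with the mode boundary
  behaviour at both horizons, for the given `(ω, m, λ)` — whether `λ` is an ANGULAR eigenvalue is
  not addressed here (for the doubly-resonant candidates it is not even angular-admissible:
  `RouteWDoublyResonantDictionary`). All Kerr–de Sitter parameter identities are HYPOTHESES here
  (discharged in the assembly file). 0 cited facts, no `sorry`.
-/

noncomputable section

open Set Complex

namespace Summit.Ventures.KdS.RouteW.DoublyResonant

open Literature.Analysis.ODE Literature.Analysis.ODE.GeneralHeun
open Literature.Geometry.Lorentzian Literature.Geometry.Lorentzian.KerrDeSitter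

/-! ### §1. Powers of `a − x` -/

/-- `d/dx (a − x)^c = −c (a − x)^{c−1}` for `x < a` (principal power of a positive real). -/
theorem hasDerivAt_const_sub_cpow (c : ℂ) {a x : ℝ} (hx : x < a) :
    HasDerivAt (fun t : ℝ => ((a - t : ℝ) : ℂ) ^ c) (-c * ((a - x : ℝ) : ℂ) ^ (c - 1)) x := by
  have hpos : (0 : ℝ) < a - x := sub_pos.2 hx
  have hslit : ((a : ℂ) - x) ∈ slitPlane := by
    have : ((a - x : ℝ) : ℂ) ∈ slitPlane := Complex.ofReal_mem_slitPlane.2 hpos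
    simpa using this
  have hf : HasDerivAt (fun z : ℂ => (a : ℂ) - z) (-1) (x : ℂ) := by
    simpa using (hasDerivAt_id (x : ℂ)).const_sub (a : ℂ)
  have h1 := (hf.cpow_const (c := c) hslit).comp_ofReal
  have hfun : (fun t : ℝ => ((a - t : ℝ) : ℂ) ^ c) = fun t : ℝ => ((a : ℂ) - (t : ℂ)) ^ c := by
    funext t; push_cast; rfl
  rw [hfun]
  refine h1.congr_deriv ?_
  push_cast
  ring

/-- `(a − x)^c ≠ 0` for `x < a`. -/
theorem const_sub_cpow_ne_zero (c : ℂ) {a x : ℝ} (hx : x < a) : ((a - x : ℝ) : ℂ) ^ c ≠ 0 :=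
  fun h => absurd ((Complex.cpow_eq_zero_iff _ _).1 h).1 (by exact_mod_cast (sub_pos.2 hx).ne')

/-- Splitting off one factor: `(a − x)^c = (a − x)^{c−1}·(a − x)` for `x < a`. -/
theorem const_sub_cpow_eq_mul_self (c : ℂ) {a x : ℝ} (hx : x < a) :
    ((a - x : ℝ) : ℂ) ^ c = ((a - x : ℝ) : ℂ) ^ (c - 1) * ((a - x : ℝ) : ℂ) := by
  have hne : ((a - x : ℝ) : ℂ) ≠ 0 := by exact_mod_cast (sub_pos.2 hx).ne'
  conv_lhs => rw [show c = (c - 1) + 1 by ring, Complex.cpow_add _ _ hne, Complex.cpow_one]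

/-- Splitting off two factors: `(a − x)^c = (a − x)^{c−2}·(a − x)²` for `x < a`. -/
theorem const_sub_cpow_eq_mul_sq (c : ℂ) {a x : ℝ} (hx : x < a) :
    ((a - x : ℝ) : ℂ) ^ c = ((a - x : ℝ) : ℂ) ^ (c - 2) * ((a - x : ℝ) : ℂ) ^ 2 := by
  have hne : ((a - x : ℝ) : ℂ) ≠ 0 := by exact_mod_cast (sub_pos.2 hx).ne'
  conv_lhs => rw [show c = (c - 2) + 2 by ring, Complex.cpow_add _ _ hne]
  rw [show (2 : ℂ) = ((2 : ℕ) : ℂ) by norm_num, Complex.cpow_natCast]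

/-- `x ↦ (a − x)^c` is `C^∞` on `{x < a}`. -/
theorem contDiffOn_const_sub_cpow (c : ℂ) (a : ℝ) :
    ContDiffOn ℝ ((⊤ : ℕ∞) : WithTop ℕ∞) (fun t : ℝ => ((a - t : ℝ) : ℂ) ^ c) (Iio a) := by
  intro x hx
  have hpos : (0 : ℝ) < a - x := sub_pos.2 hx
  have hslit : ((a - x : ℝ) : ℂ) ∈ slitPlane := Complex.ofReal_mem_slitPlane.2 hpos
  have h1 : AnalyticAt ℂ (fun z : ℂ => z ^ c) ((a - x : ℝ) : ℂ) :=
    analyticAt_id.cpow analyticAt_const hslit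
  have h3 : AnalyticAt ℝ (fun t : ℝ => ((a - t : ℝ) : ℂ)) x := by
    have : AnalyticAt ℝ (fun t : ℝ => (a : ℂ) - (t : ℂ)) x :=
      analyticAt_const.sub (Complex.ofRealCLM.analyticAt x)
    refine this.congr (Filter.Eventually.of_forall fun t => ?_)
    push_cast; rfl
  have h4 : AnalyticAt ℝ (fun t : ℝ => ((a - t : ℝ) : ℂ) ^ c) x :=
    AnalyticAt.comp (g := fun z : ℂ => z ^ c) (f := fun t : ℝ => ((a - t : ℝ) : ℂ)) (x := x)
      h1.restrictScalars h3
  exact h4.contDiffAt.contDiffWithinAt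

/-! ### §2. The F-homotopy -/

/-- **F-homotopy `y = (a − x)^p u`.** For real `a`, `U ⊆ {x < a}`, `p(p − 1 + ε) = 0` and
`α′β′ = αβ + p(γ + δ)`: if `u` solves `Hn(a; α′, β′; γ, δ, ε + 2p; q − pγ)` on `U` then
`y = (a − x)^p u` solves `Hn(a; α, β; γ, δ, ε; q)` on `U` (Umetsu's normalisation). With
`p = 1 − ε` this is the homotopy of T10 §1 (`ε′ = 2 − ε`, `α′ = α + p`, `β′ = β + p` under the
Fuchs relation, accessory shift `q = q′ + pγ`). -/
theorem isSolutionOn_homotopy {a : ℝ} {α β γ δ ε q p α' β' : ℂ} {U : Set ℝ}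
    (hU : ∀ x ∈ U, x < a) (hp : p * (p - 1 + ε) = 0) (hαβ : α' * β' = α * β + p * (γ + δ))
    {u : ℝ → ℂ} (hu : IsSolutionOn (a : ℂ) α' β' γ δ (ε + 2 * p) (q - p * γ) U u) :
    IsSolutionOn (a : ℂ) α β γ δ ε q U (fun x => ((a - x : ℝ) : ℂ) ^ p * u x) := by
  obtain ⟨u₁, u₂, h⟩ := hu
  refine ⟨fun x => -p * ((a - x : ℝ) : ℂ) ^ (p - 1) * u x + ((a - x : ℝ) : ℂ) ^ p * u₁ x,
    fun x => -p * (-(p - 1) * ((a - x : ℝ) : ℂ) ^ (p - 1 - 1)) * u x +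
      -p * ((a - x : ℝ) : ℂ) ^ (p - 1) * u₁ x +
      (-p * ((a - x : ℝ) : ℂ) ^ (p - 1) * u₁ x + ((a - x : ℝ) : ℂ) ^ p * u₂ x),
    fun x hx => ?_⟩
  have hxa := hU x hx
  obtain ⟨hd1, hd2, key⟩ := h x hx
  have hD1 := hasDerivAt_const_sub_cpow p hxa
  have hD2 := hasDerivAt_const_sub_cpow (p - 1) hxa
  refine ⟨hD1.fun_mul hd1, ((hD2.const_mul (-p)).fun_mul hd1).fun_add (hD1.fun_mul hd2), ?_⟩
  -- the equation: write every power through `ψ = (a − x)^{p−2}`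
  have e0 : ((a - x : ℝ) : ℂ) ^ p = ((a - x : ℝ) : ℂ) ^ (p - 2) * ((a - x : ℝ) : ℂ) ^ 2 :=
    const_sub_cpow_eq_mul_sq p hxa
  have e1 : ((a - x : ℝ) : ℂ) ^ (p - 1) = ((a - x : ℝ) : ℂ) ^ (p - 2) * ((a - x : ℝ) : ℂ) := by
    rw [const_sub_cpow_eq_mul_self (p - 1) hxa, show p - 1 - 1 = p - 2 by ring]
  have e2 : ((a - x : ℝ) : ℂ) ^ (p - 1 - 1) = ((a - x : ℝ) : ℂ) ^ (p - 2) := by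
    rw [show p - 1 - 1 = p - 2 by ring]
  beta_reduce
  rw [e2, e1, e0]
  unfold lead mid low at key ⊢
  push_cast at key ⊢
  linear_combination (((a : ℂ) - x) ^ (p - 2) * ((a : ℂ) - x) ^ 2) * key +
    (-(((a : ℂ) - x) ^ (p - 2) * ((a : ℂ) - x) ^ 2 * (x : ℂ) * u x)) * hαβ +
    (-(((a : ℂ) - x) ^ (p - 2) * (x : ℂ) * ((x : ℂ) - 1) * ((a : ℂ) - x) * u x)) * hp

/-! ### §3. Packaging: a smooth transformed solution solves Hatsuda's connection problem -/

/-- **From a smooth solution of the F-homotoped equation to Hatsuda's connection problem.** On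
Kerr–de Sitter Heun data with `z_r > 1` and RESONANT `γ = heunGamma = N + 1`, `N ∈ ℕ`: if `u` is
`C^∞` on `ℝ`, solves `Hn(z_r; α′, β′; γ, δ, ε + 2p; v − pγ)` on `(0, 1)` (with `p(p − 1 + ε) = 0`,
`α′β′ = σ₊σ₋ + p(γ + δ)`, `v = heunV(λ)`) and `u ≢ 0` on `(0, 1)`, then `y = (z_r − x)^p u` is a
non-trivial solution of the connection problem: it solves Hatsuda's Heun equation on `(0, 1)`
(`isSolutionOn_homotopy`), lies in the `z^{1−γ} = z^{−N}` branch at `0` with the SMOOTH cofactor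
`G = z^N (z_r − z)^p u` ("cofactor vanishing at `r₊` is allowed", STRUCTURE §8 Q3), and is smooth
across `1` (`z_r > 1`). -/
theorem hasHeunConnectionSolution_of_homotopy {M a Λ s : ℝ} {ω : ℂ} {m : ℝ} {lam : ℂ}
    (hzr : 1 < mobiusZr M a Λ) {N : ℕ} (hγ : heunGamma M a Λ s ω m = (N : ℂ) + 1)
    {p α' β' : ℂ} (hp : p * (p - 1 + heunEps M a Λ s ω m) = 0)
    (hαβ : α' * β' = heunSigmaPlus s * heunSigmaMinus M a Λ s ω m +
      p * (heunGamma M a Λ s ω m + heunDelta M a Λ s ω m))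
    {u : ℝ → ℂ} (hu : ContDiff ℝ ((⊤ : ℕ∞) : WithTop ℕ∞) u)
    (hsol : IsSolutionOn (mobiusZr M a Λ : ℂ) α' β' (heunGamma M a Λ s ω m)
      (heunDelta M a Λ s ω m) (heunEps M a Λ s ω m + 2 * p)
      (heunV M a Λ s ω m lam - p * heunGamma M a Λ s ω m) (Ioo 0 1) u)
    (hne : ∃ x ∈ Ioo (0 : ℝ) 1, u x ≠ 0) :
    HasHeunConnectionSolution M a Λ s ω m lam := by
  have hsol' := isSolutionOn_homotopy (U := Ioo (0 : ℝ) 1) (fun x hx => hx.2.trans hzr) hp hαβ hsol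
  refine ⟨fun x => ((mobiusZr M a Λ - x : ℝ) : ℂ) ^ p * u x, hsol', ?_, ?_, ?_⟩
  · -- the `z^{1−γ}` branch at `0`, cofactor `G = z^N (z_r − z)^p u` smooth on `(−1, 1)`
    refine ⟨1, one_pos, fun x => (x : ℂ) ^ N * (((mobiusZr M a Λ - x : ℝ) : ℂ) ^ p * u x), ?_, ?_⟩
    · have h1 : ContDiffOn ℝ ((⊤ : ℕ∞) : WithTop ℕ∞) (fun x : ℝ => (x : ℂ) ^ N) (Ioo (-1) 1) :=
        (Complex.ofRealCLM.contDiff.pow N).contDiffOn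
      have h2 : ContDiffOn ℝ ((⊤ : ℕ∞) : WithTop ℕ∞)
          (fun x : ℝ => ((mobiusZr M a Λ - x : ℝ) : ℂ) ^ p) (Ioo (-1) 1) :=
        (contDiffOn_const_sub_cpow p (mobiusZr M a Λ)).mono fun x hx =>
          show x < mobiusZr M a Λ by linarith [hx.2]
      exact h1.mul (h2.mul hu.contDiffOn)
    · intro x hx
      have hx0 : (x : ℂ) ≠ 0 := by exact_mod_cast hx.1.ne'
      rw [hγ, show (1 : ℂ) - ((N : ℂ) + 1) = -(N : ℂ) by ring, Complex.cpow_neg,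
        Complex.cpow_natCast, ← mul_assoc, inv_mul_cancel₀ (pow_ne_zero N hx0), one_mul]
  · -- regular at `1`: `y` itself is smooth on `(2 − z_r, z_r)`
    refine ⟨mobiusZr M a Λ - 1, by linarith, fun x => ((mobiusZr M a Λ - x : ℝ) : ℂ) ^ p * u x,
      ?_, fun x _ => rfl⟩
    have h2 : ContDiffOn ℝ ((⊤ : ℕ∞) : WithTop ℕ∞)
        (fun x : ℝ => ((mobiusZr M a Λ - x : ℝ) : ℂ) ^ p)
        (Ioo (1 - (mobiusZr M a Λ - 1)) (1 + (mobiusZr M a Λ - 1))) :=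
      (contDiffOn_const_sub_cpow p (mobiusZr M a Λ)).mono fun x hx =>
        show x < mobiusZr M a Λ by linarith [hx.2]
    exact h2.mul hu.contDiffOn
  · obtain ⟨x, hx, hux⟩ := hne
    exact ⟨x, hx, mul_ne_zero (const_sub_cpow_ne_zero p (hx.2.trans hzr)) hux⟩

end Summit.Ventures.KdS.RouteW.DoublyResonant
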